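import Summits.NavierStokesRegularity.NavierStokesRegularity.Theorems.ScenarioCensusRowF1RateTable
import Summits.NavierStokesRegularity.NavierStokesRegularity.Theorems.ScenarioCensusRowF1RateTableMaxPrinciple
import Summits.NavierStokesRegularity.NavierStokesRegularity.Theorems.ScenarioCensusRowF1PincerKill
import HarnessLib

/-!
# LINE 26 «rate-table» port, part 3/5: §7 (cont.) the weighted enstrophy of `𝒦`, `curl_eq_zero_of_slab_bound`, the kills `eq_zero_of_materialEbbing` / `eq_zero_of_idealEbbing` /
# `eq_zero_of_stretchEbbing`, slices of the read-outs

Re-homed for the scenario census (typer seat ns-census-typer-1 g9; the cells F1im / F1id and the floors DM / DI are MEMBERS OF RECORD «DECIDED IN KERNEL IN FILES» of row F1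
since census v1.78 (critic idea-crit-3 PASS; ref ns-census-ref g10 PRE-CHECK ✓ §15.23 item 45; lead-presearch label); this port makes them TREE-decided): VERBATIM PORT
of the NEW declarations (§1 material / ideal read-outs, §7 maximum principles, §9 rows) of ns-idea-3 LINE 26 «rate-table»,
`pub/ideators/ns-idea-3/lines/rate-table/line-rate-table.lean` sha16 99519954933d87d3 (2726 l., lean check rc 0, 0 sorry; the frame of §1, the Eulerian read-outs, §2–§6 and §8
are shared VERBATIM with LINES 18/20/22/24/25/27 and taken BY NAME from the landed ports — not re-declared), split for the 400-line rule into `ScenarioCensusRowF1RateTable`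
(§1) → `…RateTableMaxPrinciple` (§7a) → `…RateTableKill` (§7b) → `…RateTableRows` (§9 rows/verdicts) → `…RateTableTop` (§9 corollaries + census KEYS).  Lean text VERBATIM
in namespace `…Theorems.ScenarioCensus.RateTable` (the line's `…Cruxes.ScenarioCensusRowF1.RateTableLine` re-homed), shared names spelled by namespace (`EulerianPincer.…`,
`LiouvilleSocket.…`, `FrozenTop.…`, `InviscidTop.…`, …); port edits: the bracket lines `section …` / `end …` dropped (no `variable`s), `@[conjecture]` on the residual
`TableSlack` (≡ `ScenarioCensus.Row_F1`, OPEN), one-line docstrings added where missing (gate lint), two `have` statements spell the τ-tool's `lapD` (defeq; proof text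
only).  Statements untouched.

No census VALUE is moved here (row F1 stays OPEN-WITH-LINE; the members become TREE-decided by name); NS regularity is NOT proved; `Row_F1` is untouched (zero
movement, `tableSlack_iff_rowF1`); no summit statement is proved by this file. Lemmas that restate already-landed tree declarations are taken BY NAME (gate lint `dedup.landed`): `materialNonIncreasing_ancient_trivial` = `IntegratedQuench.eq_zero_of_nonIntensifying`.
-/

-- the summit and its single problem share the name `NavierStokesRegularity` (D-0017 nested layout)
set_option linter.dupNamespace false

noncomputable section

open MeasureTheory Set Function Filter TopologicalSpace Metric
open scoped Topology NNReal ENNReal InnerProductSpace RealInnerProductSpace Laplacian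

namespace Summit.NavierStokesRegularity.NavierStokesRegularity.Theorems.ScenarioCensus.RateTable

open Literature.Analysis Literature.Analysis.FluidPDE
open Summit.NavierStokesRegularity.NavierStokesRegularity.Theorems

/-- Joint continuity of the weighted enstrophy density `(s, y) ↦ (−s)^p |curl W(s)(y)|²` of `W ∈ 𝒦` on every
closed slab of the open past. -/
theorem continuousOn_weightedEnstrophy {C : ℝ} {W : ℝ → LiouvilleSocket.E3 → LiouvilleSocket.E3} (hW : IsTypeIAncientMild C W) (p : ℝ)
    {s₀ s₁ : ℝ} (hs₁ : s₁ < 0) :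
    ContinuousOn (uncurry fun σ (y : LiouvilleSocket.E3) => (-σ) ^ p * ‖curl (W σ) y‖ ^ 2) (Icc s₀ s₁ ×ˢ univ) := by
  have hvort : IsSmoothSpaceTimeOn (Iio 0) (vorticity W) := isSmoothSpaceTimeOn_vorticity_Iio hW.contDiffOn
  have hsub : Icc s₀ s₁ ×ˢ (univ : Set LiouvilleSocket.E3) ⊆ Iio 0 ×ˢ univ :=
    prod_mono (fun σ hσ => lt_of_le_of_lt hσ.2 hs₁) Subset.rfl
  have h1 : ContinuousOn (fun z : ℝ × LiouvilleSocket.E3 => ‖uncurry (vorticity W) z‖ ^ 2) (Icc s₀ s₁ ×ˢ univ) :=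
    ((hvort.continuousOn.mono hsub).norm).pow 2
  have h2 : ContinuousOn (fun z : ℝ × LiouvilleSocket.E3 => (-z.1) ^ p) (Icc s₀ s₁ ×ˢ univ) := by
    refine (continuous_fst.neg.continuousOn).rpow_const fun z hz => Or.inl ?_
    have : z.1 ≤ s₁ := (mem_prod.1 hz).1.2
    exact (neg_pos.2 (lt_of_le_of_lt this hs₁)).ne'
  refine (h2.mul h1).congr fun z _ => ?_
  simp only [uncurry, vorticity_apply, Pi.mul_apply]

/-- The vorticity slice `curl W(s)` of `W ∈ 𝒦` is `C²` (indeed smooth). -/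
theorem contDiff_curl_slice {C : ℝ} {W : ℝ → LiouvilleSocket.E3 → LiouvilleSocket.E3} (hW : IsTypeIAncientMild C W) {s : ℝ} (hs : s < 0) :
    ContDiff ℝ 2 (curl (W s)) := by
  have hd2 : ContDiff ℝ 2 (fderiv ℝ (W s)) :=
    ((hW.contDiff_slice hs).of_le (by norm_cast : ((3 : ℕ) : WithTop ℕ∞) ≤ _)).fderiv_right (by norm_cast)
  rw [curl_eq_curlCLM_comp]
  exact curlCLM.contDiff.comp hd2

/-- Differentiability of the slice `y ↦ (−s)^p |curl W(s)(y)|²` and its derivative along a vector: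
`D[(−s)^p|ω̃|²](y) w = (−s)^p · 2⟪ω̃, ∇ω̃ w⟫`. -/
theorem fderiv_weightedEnstrophy {C : ℝ} {W : ℝ → LiouvilleSocket.E3 → LiouvilleSocket.E3} (hW : IsTypeIAncientMild C W) (p : ℝ) {s : ℝ}
    (hs : s < 0) (y w : LiouvilleSocket.E3) :
    DifferentiableAt ℝ (fun y : LiouvilleSocket.E3 => (-s) ^ p * ‖curl (W s) y‖ ^ 2) y ∧
      fderiv ℝ (fun y : LiouvilleSocket.E3 => (-s) ^ p * ‖curl (W s) y‖ ^ 2) y w =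
        (-s) ^ p * (2 * ⟪curl (W s) y, fderiv ℝ (curl (W s)) y w⟫) := by
  have hd : DifferentiableAt ℝ (curl (W s)) y := ((contDiff_curl_slice hW hs).differentiable (by norm_cast)) y
  have hd2 : DifferentiableAt ℝ (fun y : LiouvilleSocket.E3 => ‖curl (W s) y‖ ^ 2) y := hd.hasFDerivAt.norm_sq.differentiableAt
  refine ⟨hd2.const_mul _, ?_⟩
  rw [fderiv_const_mul hd2, _root_.smul_apply, FluidPDE.fderiv_norm_sq_comp_apply hd w, smul_eq_mul]

/-- From `(−s)^p |ω̃(s,y)|² ≤ K² (−s₀)^{p−2}` for all `s₀ < s` and `p < 2`: `ω̃(s, y) = 0` (`s₀ → −∞`). -/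
theorem curl_eq_zero_of_slab_bound {K p : ℝ} (hp : p < 2) {W : ℝ → LiouvilleSocket.E3 → LiouvilleSocket.E3} {s : ℝ} (hs : s < 0) {y : LiouvilleSocket.E3}
    (h : ∀ s₀ < s, (-s) ^ p * ‖curl (W s) y‖ ^ 2 ≤ K ^ 2 * (-s₀) ^ (p - 2)) : curl (W s) y = 0 := by
  have hlim0 : Tendsto (fun σ : ℝ => (-σ) ^ (p - 2)) atBot (𝓝 0) := by
    have h := (tendsto_rpow_neg_atTop (by linarith : 0 < 2 - p)).comp tendsto_neg_atBot_atTop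
    refine h.congr' (Eventually.of_forall fun σ => ?_)
    simp only [Function.comp_apply]
    congr 1
    ring
  have hlim : Tendsto (fun σ : ℝ => K ^ 2 * (-σ) ^ (p - 2)) atBot (𝓝 0) := by
    simpa using hlim0.const_mul (K ^ 2)
  have hle : (-s) ^ p * ‖curl (W s) y‖ ^ 2 ≤ 0 :=
    ge_of_tendsto hlim ((eventually_lt_atBot s).mono fun s₀ hs₀ => h s₀ hs₀)
  have hs0 : 0 < (-s) ^ p := Real.rpow_pos_of_pos (neg_pos.2 hs) _
  have hsq : ‖curl (W s) y‖ ^ 2 ≤ 0 := by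
    by_contra hc
    push Not at hc
    linarith [mul_pos hs0 hc]
  have h0 : ‖curl (W s) y‖ ^ 2 = 0 := le_antisymm hsq (sq_nonneg _)
  exact norm_eq_zero.1 ((pow_eq_zero_iff two_ne_zero).1 h0)

/-- **THE MATERIAL KILL: a MATERIALLY θ-EBBING `𝒦` is trivial** (`θ < 1`).  `W ∈ 𝒦_C` with
`⟪ω̃, ∂ₛω̃ + (W·∇)ω̃⟫ ≤ θ |ω̃|²/(−s)` (half the MATERIAL rate of `|ω̃|²` against the self-similar rate) at every point of
the open past vanishes identically.  Proof: `q = (−s)^{2θ}|ω̃|²` is a bounded transport subsolution with drift `W`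
(`|W| ≤ C/√(−s₁)` on `[s₀, s₁] × ℝ³`), so `le_of_transportSubsolution` gives `q ≤ K²(−s₀)^{2θ−2}` on every slab;
`s₀ → −∞` kills `q`, hence `ω̃ ≡ 0`, hence `W ≡ 0` (div–curl Liouville + the Type-I gauge). -/
theorem eq_zero_of_materialEbbing {C θ : ℝ} (hθ : θ < 1) {W : ℝ → LiouvilleSocket.E3 → LiouvilleSocket.E3} (hW : IsTypeIAncientMild C W)
    (h : ∀ s < (0 : ℝ), ∀ y : LiouvilleSocket.E3,
      ⟪curl (W s) y, IntegratedQuench.vdot W s y + fderiv ℝ (curl (W s)) y (W s y)⟫ ≤ θ * ((-s)⁻¹ * ‖curl (W s) y‖ ^ 2)) :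
    ∀ s < (0 : ℝ), ∀ y : LiouvilleSocket.E3, W s y = 0 := by
  obtain ⟨K, hK0, hK⟩ := EulerianPincer.exists_neg_mul_norm_curl_le C
  have hKW := hK hW
  have hC := hW.nonneg
  -- the slab estimate, by the first-order maximum principle
  have hslab : ∀ s₀ s₁ : ℝ, s₀ < s₁ → s₁ < 0 → ∀ t ∈ Icc s₀ s₁, ∀ y : LiouvilleSocket.E3,
      (-t) ^ (2 * θ) * ‖curl (W t) y‖ ^ 2 ≤ K ^ 2 * (-s₀) ^ (2 * θ - 2) := by
    intro s₀ s₁ hs₀₁ hs₁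
    have hs₀ : s₀ < 0 := hs₀₁.trans hs₁
    have hΛ : 0 ≤ C / Real.sqrt (-s₁) := div_nonneg hC (Real.sqrt_nonneg _)
    refine le_of_transportSubsolution (q := fun σ (y : LiouvilleSocket.E3) => (-σ) ^ (2 * θ) * ‖curl (W σ) y‖ ^ 2) (b := W)
      (B := K ^ 2 * (-s₁) ^ (2 * θ - 2)) hΛ (continuousOn_weightedEnstrophy hW (2 * θ) hs₁) ?_ ?_ ?_
    · intro t ht y
      have ht0 : t < 0 := lt_of_le_of_lt ht.2 hs₁
      refine (EulerianPincer.weightedEnstrophy_le (p := 2 * θ) hW hKW ht0 y).trans ?_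
      refine mul_le_mul_of_nonneg_left ?_ (sq_nonneg K)
      exact Real.rpow_le_rpow_of_nonpos (neg_pos.2 hs₁) (by linarith [ht.2]) (by linarith)
    · intro y
      exact EulerianPincer.weightedEnstrophy_le (p := 2 * θ) hW hKW hs₀ y
    · intro t ht y _
      have ht0 : t < 0 := lt_of_le_of_lt ht.2 hs₁
      refine ⟨?_, (fderiv_weightedEnstrophy hW (2 * θ) ht0 y (W t y)).1, ?_⟩
      · refine (hW.norm_le ht0 y).trans ?_
        exact div_le_div_of_nonneg_left hC (Real.sqrt_pos.2 (neg_pos.2 hs₁))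
          (Real.sqrt_le_sqrt (by linarith [ht.2]))
      · refine ⟨_, EulerianPincer.hasDerivAt_weightedEnstrophy hW (2 * θ) ht0 y, ?_⟩
        rw [(fderiv_weightedEnstrophy hW (2 * θ) ht0 y (W t y)).2]
        have ht0' : 0 < -t := neg_pos.2 ht0
        have hA : 0 ≤ (-t) ^ (2 * θ) := Real.rpow_nonneg ht0'.le _
        have e : (-t) ^ (2 * θ - 1) = (-t) ^ (2 * θ) * (-t)⁻¹ := by
          rw [Real.rpow_sub_one ht0'.ne', div_eq_mul_inv]
        have hm := mul_le_mul_of_nonneg_left (h t ht0 y) hA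
        rw [inner_add_right] at hm
        rw [e]
        nlinarith [hm]
  -- let `s₀ → −∞`
  refine EulerianPincer.eq_zero_of_curl_eq_zero hW fun s hs y => ?_
  exact curl_eq_zero_of_slab_bound (K := K) (by linarith) hs fun s₀ hs₀ => hslab s₀ s hs₀ hs s ⟨hs₀.le, le_rfl⟩ y

/-- **THE IDEAL KILL: an IDEALLY θ-EBBING `𝒦` is trivial** (`θ < 1`).  `W ∈ 𝒦_C` with
`⟪ω̃, ∂ₛω̃ − Δω̃⟫ ≤ θ |ω̃|²/(−s)` (half the IDEAL-EULER rate of `|ω̃|²` — fixed point, diffusion removed — against the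
self-similar rate) at every point of the open past vanishes identically.  Proof: `q = (−s)^{2θ}|ω̃|²` is a bounded
HEAT subsolution `∂ₛq ≤ Δq` on every slab (Kato's identity `Δ|ω̃|² = 2⟪Δω̃, ω̃⟫ + 2|∇ω̃|²_F`), so the tree's whole-space
weak maximum principle `le_of_subsolution` (drift `0`) gives `q ≤ K²(−s₀)^{2θ−2}`; `s₀ → −∞`. -/
theorem eq_zero_of_idealEbbing {C θ : ℝ} (hθ : θ < 1) {W : ℝ → LiouvilleSocket.E3 → LiouvilleSocket.E3} (hW : IsTypeIAncientMild C W)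
    (h : ∀ s < (0 : ℝ), ∀ y : LiouvilleSocket.E3,
      ⟪curl (W s) y, IntegratedQuench.vdot W s y - (Δ (curl (W s))) y⟫ ≤ θ * ((-s)⁻¹ * ‖curl (W s) y‖ ^ 2)) :
    ∀ s < (0 : ℝ), ∀ y : LiouvilleSocket.E3, W s y = 0 := by
  obtain ⟨K, hK0, hK⟩ := EulerianPincer.exists_neg_mul_norm_curl_le C
  have hKW := hK hW
  -- the slab estimate, by the tree's second-order maximum principle with zero drift
  have hslab : ∀ s₀ s₁ : ℝ, s₀ < s₁ → s₁ < 0 → ∀ t ∈ Icc s₀ s₁, ∀ y : LiouvilleSocket.E3,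
      (-t) ^ (2 * θ) * ‖curl (W t) y‖ ^ 2 ≤ K ^ 2 * (-s₀) ^ (2 * θ - 2) := by
    intro s₀ s₁ hs₀₁ hs₁
    have hs₀ : s₀ < 0 := hs₀₁.trans hs₁
    refine HalfSpaceWindowDoorCirculationCarryingRigidityWholeSpaceMaxPrinciple.le_of_subsolution
      (q := fun σ (y : LiouvilleSocket.E3) => (-σ) ^ (2 * θ) * ‖curl (W σ) y‖ ^ 2) (b := fun _ _ => (0 : LiouvilleSocket.E3)) (Λ := 0)
      (B := K ^ 2 * (-s₁) ^ (2 * θ - 2)) le_rfl (continuousOn_weightedEnstrophy hW (2 * θ) hs₁) ?_ ?_ ?_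
    · intro t ht y
      have ht0 : t < 0 := lt_of_le_of_lt ht.2 hs₁
      refine (EulerianPincer.weightedEnstrophy_le (p := 2 * θ) hW hKW ht0 y).trans ?_
      refine mul_le_mul_of_nonneg_left ?_ (sq_nonneg K)
      exact Real.rpow_le_rpow_of_nonpos (neg_pos.2 hs₁) (by linarith [ht.2]) (by linarith)
    · intro y
      exact EulerianPincer.weightedEnstrophy_le (p := 2 * θ) hW hKW hs₀ y
    · intro t ht y _
      have ht0 : t < 0 := lt_of_le_of_lt ht.2 hs₁
      have ht0' : 0 < -t := neg_pos.2 ht0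
      have hcurl : ContDiff ℝ 2 (curl (W t)) := contDiff_curl_slice hW ht0
      have hn2 : ContDiff ℝ 2 (fun y : LiouvilleSocket.E3 => ‖curl (W t) y‖ ^ 2) := ContDiff.norm_sq ℝ hcurl
      have hqC2 : ContDiff ℝ 2 (fun y : LiouvilleSocket.E3 => (-t) ^ (2 * θ) * ‖curl (W t) y‖ ^ 2) := contDiff_const.mul hn2
      refine ⟨by simp, ⟨univ, isOpen_univ, mem_univ _, hqC2.contDiffOn⟩, ?_⟩
      refine ⟨_, EulerianPincer.hasDerivAt_weightedEnstrophy hW (2 * θ) ht0 y, ?_⟩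
      have hΔ : (Δ (fun y : LiouvilleSocket.E3 => (-t) ^ (2 * θ) * ‖curl (W t) y‖ ^ 2)) y =
          (-t) ^ (2 * θ) * (2 * ⟪curl (W t) y, (Δ (curl (W t))) y⟫
            + 2 * frobeniusNormSq (fderiv ℝ (curl (W t)) y)) := by
        have e : (fun y : LiouvilleSocket.E3 => (-t) ^ (2 * θ) * ‖curl (W t) y‖ ^ 2) =
            (-t) ^ (2 * θ) • fun y : LiouvilleSocket.E3 => ‖curl (W t) y‖ ^ 2 := by
          funext y; simp [smul_eq_mul]
        rw [e, InnerProductSpace.laplacian_smul ((-t) ^ (2 * θ)) hn2.contDiffAt, laplacian_norm_sq_comp hcurl,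
          smul_eq_mul, real_inner_comm]
      rw [map_zero, add_zero, hΔ]
      have hA : 0 ≤ (-t) ^ (2 * θ) := Real.rpow_nonneg ht0'.le _
      have hF : 0 ≤ frobeniusNormSq (fderiv ℝ (curl (W t)) y) := frobeniusNormSq_nonneg _
      have e : (-t) ^ (2 * θ - 1) = (-t) ^ (2 * θ) * (-t)⁻¹ := by
        rw [Real.rpow_sub_one ht0'.ne', div_eq_mul_inv]
      have hm := mul_le_mul_of_nonneg_left (h t ht0 y) hA
      rw [inner_sub_right] at hm
      rw [e]
      nlinarith [hm, mul_nonneg hA hF]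
  -- let `s₀ → −∞`
  refine EulerianPincer.eq_zero_of_curl_eq_zero hW fun s hs y => ?_
  exact curl_eq_zero_of_slab_bound (K := K) (by linarith) hs fun s₀ hs₀ => hslab s₀ s hs₀ hs s ⟨hs₀.le, le_rfl⟩ y

/-- **THE STRETCHING CELL BY THE SAME METHOD** (LINE 23/24's allowance kill — proved there by the tree's comparison
certificate — RE-PROVED by the drift–diffusion maximum principle, completing the uniform proof of the table): `W ∈ 𝒦_C`
with `⟪ω̃, (ω̃·∇)W⟫ ≤ θ|ω̃|²/(−s)` (`θ < 1`) everywhere on the open past vanishes identically.  `q = (−s)^{2θ}|ω̃|²` is a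
bounded subsolution of `∂ₛq + W·∇q ≤ Δq` (drift `W`, `|W| ≤ C/√(−s₁)` on the slab): tree `le_of_subsolution`. -/
theorem eq_zero_of_stretchEbbing {C θ : ℝ} (hθ : θ < 1) {W : ℝ → LiouvilleSocket.E3 → LiouvilleSocket.E3} (hW : IsTypeIAncientMild C W)
    (h : ∀ s < (0 : ℝ), ∀ y : LiouvilleSocket.E3,
      ⟪curl (W s) y, fderiv ℝ (W s) y (curl (W s) y)⟫ ≤ θ * ((-s)⁻¹ * ‖curl (W s) y‖ ^ 2)) :
    ∀ s < (0 : ℝ), ∀ y : LiouvilleSocket.E3, W s y = 0 := by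
  obtain ⟨K, hK0, hK⟩ := EulerianPincer.exists_neg_mul_norm_curl_le C
  have hKW := hK hW
  have hC := hW.nonneg
  have hslab : ∀ s₀ s₁ : ℝ, s₀ < s₁ → s₁ < 0 → ∀ t ∈ Icc s₀ s₁, ∀ y : LiouvilleSocket.E3,
      (-t) ^ (2 * θ) * ‖curl (W t) y‖ ^ 2 ≤ K ^ 2 * (-s₀) ^ (2 * θ - 2) := by
    intro s₀ s₁ hs₀₁ hs₁
    have hs₀ : s₀ < 0 := hs₀₁.trans hs₁
    have hΛ : 0 ≤ C / Real.sqrt (-s₁) := div_nonneg hC (Real.sqrt_nonneg _)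
    refine HalfSpaceWindowDoorCirculationCarryingRigidityWholeSpaceMaxPrinciple.le_of_subsolution
      (q := fun σ (y : LiouvilleSocket.E3) => (-σ) ^ (2 * θ) * ‖curl (W σ) y‖ ^ 2) (b := W) (Λ := C / Real.sqrt (-s₁))
      (B := K ^ 2 * (-s₁) ^ (2 * θ - 2)) hΛ (continuousOn_weightedEnstrophy hW (2 * θ) hs₁) ?_ ?_ ?_
    · intro t ht y
      have ht0 : t < 0 := lt_of_le_of_lt ht.2 hs₁
      refine (EulerianPincer.weightedEnstrophy_le (p := 2 * θ) hW hKW ht0 y).trans ?_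
      refine mul_le_mul_of_nonneg_left ?_ (sq_nonneg K)
      exact Real.rpow_le_rpow_of_nonpos (neg_pos.2 hs₁) (by linarith [ht.2]) (by linarith)
    · intro y
      exact EulerianPincer.weightedEnstrophy_le (p := 2 * θ) hW hKW hs₀ y
    · intro t ht y _
      have ht0 : t < 0 := lt_of_le_of_lt ht.2 hs₁
      have ht0' : 0 < -t := neg_pos.2 ht0
      have hcurl : ContDiff ℝ 2 (curl (W t)) := contDiff_curl_slice hW ht0
      have hn2 : ContDiff ℝ 2 (fun y : LiouvilleSocket.E3 => ‖curl (W t) y‖ ^ 2) := ContDiff.norm_sq ℝ hcurl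
      have hqC2 : ContDiff ℝ 2 (fun y : LiouvilleSocket.E3 => (-t) ^ (2 * θ) * ‖curl (W t) y‖ ^ 2) := contDiff_const.mul hn2
      refine ⟨?_, ⟨univ, isOpen_univ, mem_univ _, hqC2.contDiffOn⟩, ?_⟩
      · refine (hW.norm_le ht0 y).trans ?_
        exact div_le_div_of_nonneg_left hC (Real.sqrt_pos.2 (neg_pos.2 hs₁))
          (Real.sqrt_le_sqrt (by linarith [ht.2]))
      refine ⟨_, EulerianPincer.hasDerivAt_weightedEnstrophy hW (2 * θ) ht0 y, ?_⟩
      have hΔ : (Δ (fun y : LiouvilleSocket.E3 => (-t) ^ (2 * θ) * ‖curl (W t) y‖ ^ 2)) y =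
          (-t) ^ (2 * θ) * (2 * ⟪curl (W t) y, (Δ (curl (W t))) y⟫
            + 2 * frobeniusNormSq (fderiv ℝ (curl (W t)) y)) := by
        have e : (fun y : LiouvilleSocket.E3 => (-t) ^ (2 * θ) * ‖curl (W t) y‖ ^ 2) =
            (-t) ^ (2 * θ) • fun y : LiouvilleSocket.E3 => ‖curl (W t) y‖ ^ 2 := by
          funext y; simp [smul_eq_mul]
        rw [e, InnerProductSpace.laplacian_smul ((-t) ^ (2 * θ)) hn2.contDiffAt, laplacian_norm_sq_comp hcurl,
          smul_eq_mul, real_inner_comm]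
      rw [(fderiv_weightedEnstrophy hW (2 * θ) ht0 y (W t y)).2, hΔ]
      have hA : 0 ≤ (-t) ^ (2 * θ) := Real.rpow_nonneg ht0'.le _
      have hF : 0 ≤ frobeniusNormSq (fderiv ℝ (curl (W t)) y) := frobeniusNormSq_nonneg _
      have e : (-t) ^ (2 * θ - 1) = (-t) ^ (2 * θ) * (-t)⁻¹ := by
        rw [Real.rpow_sub_one ht0'.ne', div_eq_mul_inv]
      -- the vorticity equation of `W`: `∂ₛω̃ = Δω̃ − ∇ω̃ W + ∇W ω̃`
      have hv : IntegratedQuench.vdot W t y = (Δ (curl (W t))) y - fderiv ℝ (curl (W t)) y (W t y)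
          + fderiv ℝ (W t) y (curl (W t) y) := rfl
      have hm := mul_le_mul_of_nonneg_left (h t ht0 y) hA
      rw [e, hv, inner_add_right, inner_sub_right]
      nlinarith [hm, mul_nonneg hA hF]
  refine EulerianPincer.eq_zero_of_curl_eq_zero hW fun s hs y => ?_
  exact curl_eq_zero_of_slab_bound (K := K) (by linarith) hs fun s₀ hs₀ => hslab s₀ s hs₀ hs s ⟨hs₀.le, le_rfl⟩ y

/-- The material read-out of the slice data of `W ∈ 𝒦` at lag `τ` is `⟪ω̃, ∂ₛω̃ + (W·∇)ω̃⟫ − θ τ⁻¹ |ω̃|²`. -/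
theorem matOf_slice {C : ℝ} {W : ℝ → LiouvilleSocket.E3 → LiouvilleSocket.E3} (hW : IsTypeIAncientMild C W) (θ τ : ℝ) {s : ℝ} (hs : s < 0)
    (y : LiouvilleSocket.E3) :
    matOf θ τ (W s y) (fderiv ℝ (W s) y) (fderiv ℝ (fderiv ℝ (W s)) y) (FrozenTop.lapD (W s) y) =
      ⟪curl (W s) y, IntegratedQuench.vdot W s y + fderiv ℝ (curl (W s)) y (W s y)⟫ - θ * (τ⁻¹ * ‖curl (W s) y‖ ^ 2) := by
  rw [matOf, EulerianPincer.ebbOf_slice hW θ τ hs y, ← adv_eq ((hW.contDiff_slice hs).of_le (by norm_cast)) y, convect_apply,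
    inner_add_right]
  ring

/-- The ideal read-out of the slice data of `W ∈ 𝒦` at lag `τ` is `⟪ω̃, ∂ₛω̃ − Δω̃⟫ − θ τ⁻¹ |ω̃|²`. -/
theorem idlOf_slice {C : ℝ} {W : ℝ → LiouvilleSocket.E3 → LiouvilleSocket.E3} (hW : IsTypeIAncientMild C W) (θ τ : ℝ) {s : ℝ} (hs : s < 0)
    (y : LiouvilleSocket.E3) :
    idlOf θ τ (W s y) (fderiv ℝ (W s) y) (fderiv ℝ (fderiv ℝ (W s)) y) (FrozenTop.lapD (W s) y) =
      ⟪curl (W s) y, IntegratedQuench.vdot W s y - (Δ (curl (W s))) y⟫ - θ * (τ⁻¹ * ‖curl (W s) y‖ ^ 2) := by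
  rw [idlOf, EulerianPincer.ebbOf_slice hW θ τ hs y, ← dif_eq ((hW.contDiff_slice hs).of_le (by norm_cast)) y, inner_sub_right]
  ring

end Summit.NavierStokesRegularity.NavierStokesRegularity.Theorems.ScenarioCensus.RateTable

end
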